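import Literature.Topology.FourManifolds.LinkGaussDiagrams
import Literature.Topology.FourManifolds.LinkLeeStates
import Literature.Topology.FourManifolds.LinkGaussDiagramsRelabel
import Mathlib.GroupTheory.Perm.Cycle.Basic
import Mathlib.Dynamics.PeriodicPts.Defs
import HarnessLib

/-!
# Realisability of link Gauss diagrams: regular projections of links

The knot tower reads the Gauss diagram of a smooth knot `K : Knot` through a **regular projection**
`Knot.RegularProjection K` / `Knot.HasGaussDiagram K G` (`GaussDiagrams.lean`): a diagram, strictly
increasing parameters `θ` of the `2n` passages within one period, and six geometric clauses on the
stereographic plane curve `K.planeCurve`. This file is the link analogue for `LinkGaussDiagram`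
(`LinkGaussDiagrams.lean`: knot-style chord data + traversal successor `next : Equiv.Perm (Fin 2n)`
+ `free` chord-free circles): `Link.RegularProjection L` for `L : Link ι` (`Knots.lean`) and
`Link.HasGaussDiagram L D := ∃ P : L.RegularProjection, P.diagram = D` (GPV (2000), §1: a Gauss
diagram of an `m`-component link is drawn on `m` circles; Rolfsen (1976), §3.E).

## Contents

* §1 `IsTraversalOrder next comp θ`: "the parameter `θ` increases along the successor `next`,
  with ONE wrap point per component, inside a window of length `2π`", for an ARBITRARY
  permutation `next` (saddles `next ↦ next * swap p q` and the chord insertions of Reidemeister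
  moves destroy any block-contiguous numbering, so none is assumed): `comp` is `next`-invariant;
  at most one wrap point `θ (next p) ≤ θ p` per fibre of `comp`; `θ p < θ q + 2π` on a fibre.
  Consequences: every cycle has a wrap point (`exists_wrap`), so a fibre of `comp` is ONE cycle
  of `next` (`sameCycle_iff`); from the base point `b = next d` of the wrap point `d` the
  parameters read `θ b < θ (next b) < ⋯ < θ d < θ b + 2π` (`lt_of_wrap`, `strictMono_of_wrap`),
  the knot picture re-based (`isTraversalOrder_finRotate`: the knot tower is `next = finRotate`,
  wrap point `2n - 1`); `(comp, θ)` is injective, even modulo `2π` (`eq_of_θ_eq`,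
  `eq_of_θ_eq_add_int_mul`).
* §2 `Link.RegularProjection L`: the diagram; `comp p : ι` and `θ p : ℝ` for every marked point
  (a traversal order for `diagram.next`); an embedding `freeComp : Fin diagram.free ↪ ι` onto
  the components carrying no marked point (`range freeComp = (range comp)ᶜ`: the arcs
  `diagram.Arc = Fin 2n ⊕ Fin free` correspond canonically to the geometric arcs, and `ι` is
  finite, `finite_index`); and the knot clauses indexed by components: `northPole_notMem`,
  `deriv_ne_zero` for every component, `double`, ONE clause `eq_or_crossing` on `ι × ℝ` (a
  coincidence `γ_a s = γ_b t` is `a = b ∧ s ≡ t (mod 2π)` or, up to `2π`-shifts, the pair of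
  passages of a chord — covering self- and mutual crossings, embeddedness of free components
  and their disjointness from the rest: `exists_int_of_free`, `planeCurve_ne_of_free`),
  `heightCurve_lt`, and `sign_eq` through `Matrix.det` (the knot clause literally;
  `det_ne_zero`). `Link.HasGaussDiagram L D` is, as for knots, an honest predicate on the
  embedding, NOT invariant under isotopy.
* §3 The knot tower specialises: `LinkGaussDiagram.ofKnotDiagram G` is `ofGaussDiagram G` with
  the CORRECT number of free circles (`free = 1` when `G.n = 0`: a crossingless knot projection
  is one free circle, `unknots 1`, whereas `ofGaussDiagram GaussDiagram.empty = unknots 0`);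
  `Link.RegularProjection.ofKnot : K.RegularProjection → (Link.ofKnot K).RegularProjection`,
  whence `Link.hasGaussDiagram_ofKnot : K.HasGaussDiagram G → (Link.ofKnot K).HasGaussDiagram
  (ofKnotDiagram G)` (and the `n ≠ 0` / `n = 0` forms).
* §4 Symmetries: relabelling (`Link.RegularProjection.relabel τ κ φ` reads
  `P.diagram.relabel τ κ` of `LinkGaussDiagramsRelabel`; `Link.HasGaussDiagram.relabel`,
  `.of_isRelabelling`) and re-parametrisation of each component by whole periods (`shift`).
* §5 Checkerboard colourings (`LinkGaussDiagram.IsCheckerboard`, `LinkLeeStates`), the input of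
  the next layer: they transfer along `ofKnotDiagram` (`isCheckerboard_ofKnotDiagram_iff`) and
  force an even number of chord ends on every component (`IsCheckerboard.even_minimalPeriod`).

## Design notes

`comp` is data: the cycles of `next` only give the partition of the marked points, and the
geometric clauses cannot be stated without naming the component of `L` carrying each cycle. No
base point is part of the data (unlike `Knot.RegularProjection`, based at position `0`): on
`Link.ofKnot K` every rotation of a knot reading is a link reading. `eq_or_crossing` keeps the
knot tower's "unordered pair up to shifts" form, now in `Set (ι × ℝ)` (`Set.pair_eq_pair_iff`).

## Not here (future work, deliberately no named facts)

*Generic projections exist for links* (the knot fact `Knot.exists_hasGaussDiagram_of_isIsotopic`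
component by component plus mutual transversality); *realisable link diagrams are checkerboard
colourable*, `∀ P : L.RegularProjection, ∃ c, P.diagram.IsCheckerboard c`, by the winding-number
engine of `RegularProjectionParity` (Kauffman (1999), §2: planar Gauss codes are evenly
intersticed), which feeds `dichotomy_of_isCheckerboard` of `LinkKhDichotomy` (`d² = 0`); the
converse of `hasGaussDiagram_ofKnot` up to `GaussDiagram.rotate`; uniqueness of the reading up
to `LinkGaussDiagram.IsRelabelling`.

## References

* M. Goussarov, M. Polyak, O. Viro, *Finite-type invariants of classical and virtual knots*,
  Topology 39 (2000), §1 (Gauss diagrams of knots and links). [cite: GPV2000, §1]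
* D. Rolfsen, *Knots and Links* (1976), §2.A (links), §3.E (regular projections).
  [cite: Rolfsen1976, §3.E]
* L. H. Kauffman, *Virtual knot theory*, European J. Combin. 20 (1999), §2 (planar Gauss codes
  are evenly intersticed). [cite: Kauffman1999, §2]
* J. Rasmussen, *Khovanov homology and the slice genus*, Invent. Math. 182 (2010), §2.3
  (adjacent Seifert circles carry different labels), §4.1. [cite: Rasmussen2010, §2.3]
-/

noncomputable section

open Function Set

namespace Literature.Topology.FourManifolds

/-! ## 1. Traversal orders: "`θ` increases along `next`, one wrap per component" -/

/-- **Traversal order.** For a successor permutation `next` of `m` marked points, a component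
assignment `comp` and parameters `θ`: `comp` is constant along `next`; in each fibre of `comp` at
most one point `p` is a *wrap point*, `θ (next p) ≤ θ p` (everywhere else `θ` strictly increases
along `next`); and the parameters of one fibre lie in an open window of length `2π`. On
`next = finRotate m` with a constant `comp`, the knot tower's `StrictMono θ ∧ ∀ i j, θ i < θ j + 2π`
is the special case with wrap point `m - 1`, base point `0` (`isTraversalOrder_finRotate`).
GPV (2000), §1 (one circle per component). [folklore] -/
structure IsTraversalOrder {m : ℕ} {ι : Type*} (next : Equiv.Perm (Fin m)) (comp : Fin m → ι)
    (θ : Fin m → ℝ) : Prop where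
  /-- Successive marked points lie on the same component. -/
  comp_next : ∀ p, comp (next p) = comp p
  /-- At most one wrap point per component: elsewhere the parameter increases along `next`. -/
  wrap_unique : ∀ p q, comp p = comp q → θ (next p) ≤ θ p → θ (next q) ≤ θ q → p = q
  /-- The parameters of one component lie in one period. -/
  lt_add_two_pi : ∀ p q, comp p = comp q → θ p < θ q + 2 * Real.pi

namespace IsTraversalOrder

variable {m : ℕ} {ι : Type*} {next : Equiv.Perm (Fin m)} {comp : Fin m → ι} {θ : Fin m → ℝ}

/-- **Every cycle has a wrap point** (pure combinatorics of a finite cycle, no hypothesis: the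
increments of `θ` around a cycle cannot all be positive). [folklore] -/
theorem exists_wrap (next : Equiv.Perm (Fin m)) (θ : Fin m → ℝ) (p : Fin m) :
    ∃ d, next.SameCycle p d ∧ θ (next d) ≤ θ d := by
  by_contra hno
  push Not at hno
  have hlt : ∀ k, θ p < θ ((next ^ (k + 1)) p) := by
    intro k
    induction k with
    | zero => simpa using hno p (Equiv.Perm.SameCycle.refl _ _)
    | succ k ih =>
      refine ih.trans ?_
      rw [pow_succ' next (k + 1), Equiv.Perm.mul_apply]
      exact hno _ (Equiv.Perm.sameCycle_pow_right.2 (Equiv.Perm.SameCycle.refl _ _))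
  obtain ⟨k, hk⟩ : ∃ k, orderOf next = k + 1 :=
    Nat.exists_eq_add_one_of_ne_zero (orderOf_pos next).ne'
  have := hlt k
  rw [← hk, pow_orderOf_eq_one, Equiv.Perm.one_apply] at this
  exact lt_irrefl _ this

variable (h : IsTraversalOrder next comp θ)
include h

/-- `comp` is constant along iterates of `next`. [folklore] -/
theorem comp_pow (p : Fin m) (k : ℕ) : comp ((next ^ k) p) = comp p := by
  induction k with
  | zero => rfl
  | succ k ih => rw [pow_succ', Equiv.Perm.mul_apply, h.comp_next, ih]

/-- Points on one cycle of `next` lie on one component. [folklore] -/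
theorem comp_eq_of_sameCycle {p q : Fin m} (hpq : next.SameCycle p q) : comp p = comp q := by
  obtain ⟨k, -, rfl⟩ := hpq.exists_pow_eq'
  exact (h.comp_pow p k).symm

/-- **One cycle per component**: a fibre of `comp` is a single cycle of `next` (two cycles would
carry two wrap points). [folklore] -/
theorem sameCycle_of_comp_eq {p q : Fin m} (hpq : comp p = comp q) : next.SameCycle p q := by
  obtain ⟨d, hd, hdθ⟩ := exists_wrap next θ p
  obtain ⟨e, he, heθ⟩ := exists_wrap next θ q
  have hde : d = e := h.wrap_unique d e
    (by rw [← h.comp_eq_of_sameCycle hd, ← h.comp_eq_of_sameCycle he, hpq]) hdθ heθ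
  subst hde
  exact hd.trans he.symm

/-- The components met by chords are exactly the cycles of `next`. [folklore] -/
theorem sameCycle_iff {p q : Fin m} : next.SameCycle p q ↔ comp p = comp q :=
  ⟨h.comp_eq_of_sameCycle, h.sameCycle_of_comp_eq⟩

/-- **Increase from the base point.** If `d` is a wrap point, then walking from the base point
`next d` the parameter increases at every step that has not yet returned to the base.
[folklore] -/
theorem lt_of_wrap {d : Fin m} (hd : θ (next d) ≤ θ d) (k : ℕ)
    (hk : (next ^ (k + 1)) (next d) ≠ next d) :
    θ ((next ^ k) (next d)) < θ ((next ^ (k + 1)) (next d)) := by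
  by_contra hle
  push Not at hle
  rw [pow_succ', Equiv.Perm.mul_apply] at hle hk
  have hx : (next ^ k) (next d) = d :=
    h.wrap_unique _ d (by rw [h.comp_pow, h.comp_next]) hle hd
  exact hk (by rw [hx])

/-- The knot picture re-based: `θ b < θ (next b) < ⋯` along the first `k` steps from the base
point `b = next d` of a wrap point `d`, as long as they do not return to `b` (with
`lt_add_two_pi`: all within `θ b + 2π`). [folklore] -/
theorem strictMono_of_wrap {d : Fin m} (hd : θ (next d) ≤ θ d) {k : ℕ}
    (hk : ∀ j < k, (next ^ (j + 1)) (next d) ≠ next d) :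
    StrictMono fun j : Fin (k + 1) ↦ θ ((next ^ (j : ℕ)) (next d)) :=
  Fin.strictMono_iff_lt_succ.2 fun j ↦ by simpa using h.lt_of_wrap hd j (hk j j.isLt)

/-- **`(comp, θ)` is injective**: two marked points on one component with the same parameter
coincide (count steps from the base point of the component and use `strictMono_of_wrap`).
[folklore] -/
theorem eq_of_θ_eq {p q : Fin m} (hc : comp p = comp q) (hθ : θ p = θ q) : p = q := by
  classical
  obtain ⟨d, hd, hdθ⟩ := exists_wrap next θ p
  have hbp : next.SameCycle (next d) p := Equiv.Perm.sameCycle_apply_left.2 hd.symm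
  have hbq : next.SameCycle (next d) q := hbp.trans (h.sameCycle_of_comp_eq hc)
  -- the minimal walk from the base point `next d` to a point does not return to the base point
  have walk : ∀ {r : Fin m}, next.SameCycle (next d) r →
      ∃ n, (next ^ n) (next d) = r ∧ ∀ j < n, (next ^ (j + 1)) (next d) ≠ next d := by
    intro r hr
    refine ⟨Nat.find hr.exists_nat_pow_eq, Nat.find_spec hr.exists_nat_pow_eq,
      fun j hj heq ↦ Nat.find_min hr.exists_nat_pow_eq (Nat.sub_lt_of_pos_le (by omega) hj) ?_⟩
    calc (next ^ (Nat.find hr.exists_nat_pow_eq - (j + 1))) (next d)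
        = (next ^ (Nat.find hr.exists_nat_pow_eq - (j + 1))) ((next ^ (j + 1)) (next d)) := by
          rw [heq]
      _ = r := by
          rw [← Equiv.Perm.mul_apply, ← pow_add, Nat.sub_add_cancel hj,
            Nat.find_spec hr.exists_nat_pow_eq]
  have lt : ∀ {i j : ℕ}, (∀ j' < j, (next ^ (j' + 1)) (next d) ≠ next d) → i < j →
      θ ((next ^ i) (next d)) < θ ((next ^ j) (next d)) := @fun i j hj hij ↦
    h.strictMono_of_wrap hdθ hj (show (⟨i, by omega⟩ : Fin (j + 1)) < ⟨j, by omega⟩ from hij)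
  obtain ⟨i, rfl, hi⟩ := walk hbp
  obtain ⟨j, rfl, hj⟩ := walk hbq
  rcases lt_trichotomy i j with hij | rfl | hij
  · exact absurd hθ (lt hj hij).ne
  · rfl
  · exact absurd hθ.symm (lt hi hij).ne

/-- **`(comp, θ mod 2π)` is injective**: two marked points on one component whose parameters
differ by a multiple of `2π` coincide (the window condition forces the multiple to be `0`).
[folklore] -/
theorem eq_of_θ_eq_add_int_mul {p q : Fin m} (hc : comp p = comp q) {k : ℤ}
    (hθ : θ q = θ p + k * (2 * Real.pi)) : p = q := by
  have h1 := h.lt_add_two_pi p q hc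
  have h2 := h.lt_add_two_pi q p hc.symm
  rw [hθ] at h1 h2
  have hπ := Real.pi_pos
  have hk1 : (k : ℝ) < 1 := by nlinarith
  have hk2 : (-1 : ℝ) < k := by nlinarith
  have hk : k = 0 := by
    have hk1' : k < 1 := by exact_mod_cast hk1
    have hk2' : -1 < k := by exact_mod_cast hk2
    omega
  subst hk
  rw [Int.cast_zero, zero_mul, add_zero] at hθ
  exact h.eq_of_θ_eq hc hθ.symm

omit h in
/-- A traversal order is transported along a renumbering `τ` of the marked points: the
successor is conjugated (`τ ∘ next ∘ τ⁻¹`, the `next` of `LinkGaussDiagram.relabel`) and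
`comp`, `θ` are precomposed with `τ⁻¹`. [folklore] -/
theorem conj (h : IsTraversalOrder next comp θ) (τ : Equiv.Perm (Fin m)) :
    IsTraversalOrder (τ.symm.trans (next.trans τ)) (comp ∘ τ.symm) (θ ∘ τ.symm) where
  comp_next p := by
    show comp (τ.symm (τ (next (τ.symm p)))) = comp (τ.symm p)
    rw [Equiv.symm_apply_apply, h.comp_next]
  wrap_unique p q hc hp hq := by
    change θ (τ.symm (τ (next (τ.symm p)))) ≤ θ (τ.symm p) at hp
    change θ (τ.symm (τ (next (τ.symm q)))) ≤ θ (τ.symm q) at hq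
    rw [Equiv.symm_apply_apply] at hp hq
    exact τ.symm.injective (h.wrap_unique _ _ hc hp hq)
  lt_add_two_pi p q hc := h.lt_add_two_pi _ _ hc

omit h in
/-- A traversal order is unchanged when the parameters of each component are shifted by a
constant depending only on the component. [folklore] -/
theorem add_comp (h : IsTraversalOrder next comp θ) (f : ι → ℝ) :
    IsTraversalOrder next comp fun p ↦ θ p + f (comp p) where
  comp_next := h.comp_next
  wrap_unique p q hc hp hq := by
    rw [h.comp_next, add_le_add_iff_right] at hp hq
    exact h.wrap_unique p q hc hp hq
  lt_add_two_pi p q hc := by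
    have := h.lt_add_two_pi p q hc
    rw [hc]
    linarith

end IsTraversalOrder

/-- Only the last point of `Fin m` is not below its image under `finRotate m`. [folklore] -/
theorem val_add_one_eq_of_finRotate_le {m : ℕ} {p : Fin m} (h : finRotate m p ≤ p) :
    p.val + 1 = m := by
  cases m with
  | zero => exact p.elim0
  | succ m =>
    by_contra hne
    have hp : p ≠ Fin.last m := fun hl ↦ hne (by rw [hl, Fin.val_last])
    rw [Fin.le_def, coe_finRotate_of_ne_last hp] at h
    omega

/-- **The knot tower's reading is a traversal order**: strictly increasing parameters within one
period, read along `finRotate m` on a single component, form a traversal order (wrap point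
`m - 1`, base point `0`). [folklore] -/
theorem isTraversalOrder_finRotate {m : ℕ} {ι : Type*} (a : ι) {θ : Fin m → ℝ}
    (hθ : StrictMono θ) (hlt : ∀ i j, θ i < θ j + 2 * Real.pi) :
    IsTraversalOrder (finRotate m) (fun _ ↦ a) θ where
  comp_next _ := rfl
  wrap_unique p q _ hp hq := Fin.ext <| by
    have h1 := val_add_one_eq_of_finRotate_le (hθ.le_iff_le.1 hp)
    have h2 := val_add_one_eq_of_finRotate_le (hθ.le_iff_le.1 hq)
    omega
  lt_add_two_pi p q _ := hlt p q

/-- **Satisfiability on two components**: the successor `(0 1)(2 3)` of the Hopf link diagram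
`LinkGaussDiagram.hopfLink`, components `0, 0, 1, 1`, parameters `1, 2, 4, 1/2` (wrap points
`1` and `2`, base points `0` and `3`: `θ 3 = 1/2 < θ 2 = 4 < θ 3 + 2π`). [folklore] -/
theorem isTraversalOrder_hopfLink :
    IsTraversalOrder (m := 4) LinkGaussDiagram.hopfLink.next ![(0 : Fin 2), 0, 1, 1]
      ![(1 : ℝ), 2, 4, 1 / 2] := by
  change IsTraversalOrder (Equiv.swap (0 : Fin 4) 1 * Equiv.swap 2 3) _ _
  have hn : ⇑(Equiv.swap (0 : Fin 4) 1 * Equiv.swap 2 3 : Equiv.Perm (Fin 4)) = ![1, 0, 3, 2] := by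
    decide
  refine ⟨fun p ↦ ?_, ?_, fun p q _ ↦ ?_⟩
  · rw [hn]; fin_cases p <;> rfl
  · simp only [hn]
    intro p q
    fin_cases p <;> fin_cases q <;> simp <;> norm_num
  · have := Real.two_le_pi
    fin_cases p <;> fin_cases q <;> norm_num <;> linarith

/-! ## 2. Regular projections of links -/

namespace Link

variable {ι : Type*}

/-- **A regular projection of the link `L` with a reading of its link Gauss diagram** (the link
analogue of `Knot.RegularProjection`). Data: the diagram; for each marked point `p` the component
`comp p : ι` on which the passage happens and its parameter `θ p` (a traversal order for
`diagram.next`, see `IsTraversalOrder`: along `next` one stays on the component and the parameter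
increases, except at one wrap point per component, within one period); the matching `freeComp`
of the `free` chord-free circles of the diagram with the components of `L` carrying no passage.
Conditions, for the stereographic plane curves `γ_a = (L.component a).planeCurve` (Rolfsen
(1976), §3.E; GPV (2000), §1): every component misses the north pole and every `γ_a` is an
immersion; the two passages of chord `i` project to one point (`double`); the listed passages
are the only coincidences between all the `γ_a` on a period (`eq_or_crossing` — in particular
free components are embedded and meet no other component in projection, and there are no triple
points thanks to `bijective`); the over-passage is the higher one (`heightCurve_lt`); the sign
of chord `i` is the orientation of `(γ'ₒ, γ'ᵤ)` (`sign_eq`, right-handed crossings are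
positive), which also makes crossings transverse (`det_ne_zero`). Consequence: `ι` is finite
(`finite_index`). [cite: GPV2000, §1] -/
structure RegularProjection (L : Link ι) where
  /-- The link Gauss diagram read off the projection. -/
  diagram : LinkGaussDiagram
  /-- The component on which the passage through the marked point `p` happens. -/
  comp : Fin (2 * diagram.n) → ι
  /-- The parameter (on the component `comp p`) of the passage through the marked point `p`. -/
  θ : Fin (2 * diagram.n) → ℝ
  /-- Along `next` one stays on the component and the parameter increases, except at one wrap
  point per component; the parameters of a component lie in one period. -/
  traversal : IsTraversalOrder diagram.next comp θ
  /-- The chord-free circles of the diagram, as components of the link. -/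
  freeComp : Fin diagram.free ↪ ι
  /-- The chord-free circles are exactly the components carrying no marked point. -/
  range_freeComp : range freeComp = (range comp)ᶜ
  /-- Every component misses the centre of projection. -/
  northPole_notMem : ∀ a, northPole ∉ range (L.component a)
  /-- Every component projects to an immersed plane curve. -/
  deriv_ne_zero : ∀ a t, deriv (L.component a).planeCurve t ≠ 0
  /-- The two passages of chord `i` project to the same point. -/
  double : ∀ i, (L.component (comp (diagram.overPos i))).planeCurve (θ (diagram.overPos i)) =
    (L.component (comp (diagram.underPos i))).planeCurve (θ (diagram.underPos i))
  /-- The listed crossings are the only coincidences: if `γ_a s = γ_b t` then either `a = b` and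
  `s ≡ t (mod 2π)`, or `{(a, s), (b, t)}` is, modulo `2π` in the second coordinates, the pair of
  passages of some chord `i` (a self-crossing if `comp (overPos i) = comp (underPos i)`, a
  mutual crossing otherwise). -/
  eq_or_crossing : ∀ a b s t, (L.component a).planeCurve s = (L.component b).planeCurve t →
    (a = b ∧ ∃ k : ℤ, t = s + k * (2 * Real.pi)) ∨
      ∃ (i : Fin diagram.n) (k l : ℤ),
        ({(a, s + k * (2 * Real.pi)), (b, t + l * (2 * Real.pi))} : Set (ι × ℝ)) =
          {(comp (diagram.overPos i), θ (diagram.overPos i)),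
            (comp (diagram.underPos i), θ (diagram.underPos i))}
  /-- At chord `i` the over-passage is higher than the under-passage. -/
  heightCurve_lt : ∀ i,
    (L.component (comp (diagram.underPos i))).heightCurve (θ (diagram.underPos i)) <
      (L.component (comp (diagram.overPos i))).heightCurve (θ (diagram.overPos i))
  /-- The sign of chord `i` is the sign of `det (γ'ₒ, γ'ᵤ)` (right-handed crossings are
  positive; in particular the crossing is transverse). -/
  sign_eq : ∀ i, (diagram.sign i : ℤ) = SignType.sign (Matrix.det
    !![(deriv (L.component (comp (diagram.overPos i))).planeCurve (θ (diagram.overPos i))).1,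
        (deriv (L.component (comp (diagram.overPos i))).planeCurve (θ (diagram.overPos i))).2;
       (deriv (L.component (comp (diagram.underPos i))).planeCurve (θ (diagram.underPos i))).1,
        (deriv (L.component (comp (diagram.underPos i))).planeCurve
          (θ (diagram.underPos i))).2])

namespace RegularProjection

variable {L : Link ι} (P : L.RegularProjection)

/-- Transversality: the determinant of the two velocities at a crossing is non-zero (its sign is
`±1`). Rolfsen (1976), §3.E. [folklore] -/
theorem det_ne_zero (i : Fin P.diagram.n) : Matrix.det
    !![(deriv (L.component (P.comp (P.diagram.overPos i))).planeCurve
          (P.θ (P.diagram.overPos i))).1,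
        (deriv (L.component (P.comp (P.diagram.overPos i))).planeCurve
          (P.θ (P.diagram.overPos i))).2;
       (deriv (L.component (P.comp (P.diagram.underPos i))).planeCurve
          (P.θ (P.diagram.underPos i))).1,
        (deriv (L.component (P.comp (P.diagram.underPos i))).planeCurve
          (P.θ (P.diagram.underPos i))).2] ≠ 0 := by
  intro h
  have := P.sign_eq i
  rw [h, sign_zero] at this
  exact (P.diagram.sign i).ne_zero (by exact_mod_cast this)

/-- The two passages of a chord are different passages (different components or parameters not
congruent modulo `2π`). [folklore] -/
theorem overPos_passage_ne_underPos_passage (i : Fin P.diagram.n) (k : ℤ) :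
    (P.comp (P.diagram.overPos i), P.θ (P.diagram.overPos i) + k * (2 * Real.pi)) ≠
      (P.comp (P.diagram.underPos i), P.θ (P.diagram.underPos i)) := fun h ↦
  P.diagram.overPos_ne_underPos i i
    (P.traversal.eq_of_θ_eq_add_int_mul (Prod.ext_iff.1 h).1 (Prod.ext_iff.1 h).2.symm)

/-- A component is chord-free iff it carries no marked point. [folklore] -/
theorem mem_range_freeComp_iff (a : ι) : a ∈ range P.freeComp ↔ ∀ p, P.comp p ≠ a := by
  rw [P.range_freeComp, mem_compl_iff, mem_range, not_exists]

include P in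
/-- **The index type of a link with a regular projection is finite** (components with a passage
are in the range of `comp`, the others in the range of `freeComp`). [folklore] -/
theorem finite_index : Finite ι := by
  have hu : (univ : Set ι) = range P.comp ∪ range P.freeComp := by
    rw [P.range_freeComp, union_compl_self]
  exact finite_univ_iff.1 (hu ▸ (finite_range _).union (finite_range _))

/-- The components named in a crossing carry marked points. [folklore] -/
theorem mem_range_comp_of_pair_eq {a b : ι} {s t : ℝ} {i : Fin P.diagram.n}
    (h : ({(a, s), (b, t)} : Set (ι × ℝ)) =
      {(P.comp (P.diagram.overPos i), P.θ (P.diagram.overPos i)),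
        (P.comp (P.diagram.underPos i), P.θ (P.diagram.underPos i))}) : a ∈ range P.comp := by
  have ha : (a, s) ∈ ({(P.comp (P.diagram.overPos i), P.θ (P.diagram.overPos i)),
      (P.comp (P.diagram.underPos i), P.θ (P.diagram.underPos i))} : Set (ι × ℝ)) :=
    h ▸ mem_insert _ _
  rcases ha with ha | ha
  · exact ⟨_, (congrArg Prod.fst ha).symm⟩
  · exact ⟨_, (congrArg Prod.fst (mem_singleton_iff.1 ha)).symm⟩

/-- **A chord-free component is embedded in projection**: its plane curve identifies only
parameters congruent modulo `2π`. [folklore] -/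
theorem exists_int_of_free {a : ι} (ha : a ∉ range P.comp) {s t : ℝ}
    (hst : (L.component a).planeCurve s = (L.component a).planeCurve t) :
    ∃ k : ℤ, t = s + k * (2 * Real.pi) := by
  rcases P.eq_or_crossing a a s t hst with ⟨-, h⟩ | ⟨i, k, l, h⟩
  · exact h
  · exact absurd (P.mem_range_comp_of_pair_eq h) ha

/-- **A chord-free component meets no other component in projection.** [folklore] -/
theorem planeCurve_ne_of_free {a b : ι} (ha : a ∉ range P.comp) (hab : a ≠ b) (s t : ℝ) :
    (L.component a).planeCurve s ≠ (L.component b).planeCurve t := fun hst ↦ by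
  rcases P.eq_or_crossing a b s t hst with ⟨h, -⟩ | ⟨i, k, l, h⟩
  · exact hab h
  · exact ha (P.mem_range_comp_of_pair_eq h)

end RegularProjection

/-- The link `L` **has link Gauss diagram** `D` if some regular projection of `L`
(stereographic, from the north pole, with some numbering of the chords and of the marked points)
reads `D`. As for knots (`Knot.HasGaussDiagram`) this is an honest predicate on the embedding,
NOT invariant under isotopy of `L`. GPV (2000), §1. [cite: GPV2000, §1] -/
def HasGaussDiagram (L : Link ι) (D : LinkGaussDiagram) : Prop :=
  ∃ P : L.RegularProjection, P.diagram = D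

end Link

/-! ## 3. Sanity: the knot tower specialises -/

namespace LinkGaussDiagram

/-- **The link diagram of a knot diagram, with the correct number of free circles**: as
`LinkGaussDiagram.ofGaussDiagram` (`next = finRotate`, no free circle), except that a
crossingless knot diagram is ONE free circle. [folklore] -/
def ofKnotDiagram (G : GaussDiagram) : LinkGaussDiagram where
  n := G.n
  free := if G.n = 0 then 1 else 0
  overPos := G.overPos
  underPos := G.underPos
  sign := G.sign
  bijective := G.bijective
  next := finRotate (2 * G.n)

/-- `ofKnotDiagram` keeps the number of chords. [folklore] -/
@[simp] theorem ofKnotDiagram_n (G : GaussDiagram) : (ofKnotDiagram G).n = G.n := rfl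

/-- With at least one chord, `ofKnotDiagram` is the embedding `ofGaussDiagram` of the knot tower.
[folklore] -/
theorem ofKnotDiagram_of_ne_zero {G : GaussDiagram} (h : G.n ≠ 0) :
    ofKnotDiagram G = ofGaussDiagram G := by
  simp only [ofKnotDiagram, ofGaussDiagram, if_neg h]

/-- Without chords, `ofKnotDiagram` is the one-circle crossingless diagram `unknots 1`.
[folklore] -/
theorem ofKnotDiagram_of_eq_zero {G : GaussDiagram} (h : G.n = 0) :
    ofKnotDiagram G = unknots 1 := by
  obtain ⟨n, o, u, s, b⟩ := G
  change n = 0 at h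
  subst h
  simp only [ofKnotDiagram, unknots, if_true, LinkGaussDiagram.mk.injEq, heq_eq_eq, true_and]
  exact ⟨funext fun i ↦ i.elim0, funext fun i ↦ i.elim0, funext fun i ↦ i.elim0,
    Equiv.ext fun i ↦ i.elim0⟩

end LinkGaussDiagram

namespace Link.RegularProjection

open LinkGaussDiagram

/-- **Sanity: a regular projection of a knot is a regular projection of its one-component link**
`Link.ofKnot K`, reading `ofKnotDiagram P.diagram`: `comp` is constant, `θ` is the knot's `θ`
(`isTraversalOrder_finRotate`), the free circle (if `n = 0`) is the unique component, and each
geometric clause is the knot clause. [folklore] -/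
def ofKnot {K : Knot} (P : K.RegularProjection) : (Link.ofKnot K).RegularProjection where
  diagram := ofKnotDiagram P.diagram
  comp _ := ()
  θ := P.θ
  traversal := isTraversalOrder_finRotate () P.strictMono P.lt_add_two_pi
  freeComp := ⟨fun _ ↦ (), fun i j _ ↦ by
    have : (ofKnotDiagram P.diagram).free ≤ 1 := by
      change (if P.diagram.n = 0 then 1 else 0) ≤ 1; split <;> omega
    exact (Fin.subsingleton_iff_le_one.2 this).elim i j⟩
  range_freeComp := by
    ext a
    simp only [mem_range, mem_compl_iff, exists_const_iff, and_true]
    rw [← Fin.pos_iff_nonempty, ← Fin.pos_iff_nonempty]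
    change (0 < if P.diagram.n = 0 then 1 else 0) ↔ ¬ 0 < 2 * P.diagram.n
    split <;> omega
  northPole_notMem _ := P.northPole_notMem
  deriv_ne_zero _ := P.deriv_ne_zero
  double := P.double
  eq_or_crossing a b s t hst := by
    rcases P.eq_or_crossing s t hst with h | ⟨i, k, l, h⟩
    · exact Or.inl ⟨Subsingleton.elim a b, h⟩
    · refine Or.inr ⟨i, k, l, ?_⟩
      rcases pair_eq_pair_iff.1 h with ⟨h1, h2⟩ | ⟨h1, h2⟩
      · exact pair_eq_pair_iff.2 (Or.inl ⟨Prod.ext (Subsingleton.elim _ _) h1,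
          Prod.ext (Subsingleton.elim _ _) h2⟩)
      · exact pair_eq_pair_iff.2 (Or.inr ⟨Prod.ext (Subsingleton.elim _ _) h1,
          Prod.ext (Subsingleton.elim _ _) h2⟩)
  heightCurve_lt := P.heightCurve_lt
  sign_eq := P.sign_eq

/-- The link diagram read by `ofKnot P` is `ofKnotDiagram P.diagram`. [folklore] -/
@[simp] theorem ofKnot_diagram {K : Knot} (P : K.RegularProjection) :
    (ofKnot P).diagram = ofKnotDiagram P.diagram := rfl

end Link.RegularProjection

namespace Link

open LinkGaussDiagram

/-- **A knot with Gauss diagram `G` is a one-component link with link Gauss diagram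
`ofKnotDiagram G`.** [folklore] -/
theorem hasGaussDiagram_ofKnot {K : Knot} {G : GaussDiagram} (h : K.HasGaussDiagram G) :
    (Link.ofKnot K).HasGaussDiagram (ofKnotDiagram G) := by
  obtain ⟨P, rfl⟩ := h; exact ⟨RegularProjection.ofKnot P, rfl⟩

/-- With at least one crossing the link diagram of `Link.ofKnot K` is `ofGaussDiagram G`, the
image of the knot tower on which `LinkKhResolutions` agrees with `KhResolutions`. [folklore] -/
theorem hasGaussDiagram_ofKnot_of_ne_zero {K : Knot} {G : GaussDiagram}
    (h : K.HasGaussDiagram G) (hn : G.n ≠ 0) :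
    (Link.ofKnot K).HasGaussDiagram (ofGaussDiagram G) :=
  ofKnotDiagram_of_ne_zero hn ▸ hasGaussDiagram_ofKnot h

/-- A crossingless knot projection reads the one-circle diagram `unknots 1` (not
`ofGaussDiagram GaussDiagram.empty = unknots 0`). [folklore] -/
theorem hasGaussDiagram_ofKnot_of_eq_zero {K : Knot} {G : GaussDiagram}
    (h : K.HasGaussDiagram G) (hn : G.n = 0) :
    (Link.ofKnot K).HasGaussDiagram (unknots 1) :=
  ofKnotDiagram_of_eq_zero hn ▸ hasGaussDiagram_ofKnot h

end Link

/-! ## 4. Symmetries: relabelling and re-parametrisation -/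

namespace Link.RegularProjection

variable {ι : Type*} {L : Link ι} (P : L.RegularProjection)

/-- **Relabelling a regular projection**: renumber the marked points by `τ`, the chords by `κ`
and the free circles by `φ`; the diagram read becomes `P.diagram.relabel τ κ` (`next` conjugated,
`LinkGaussDiagram.relabel`), the new marked point `τ p` has the component and parameter of `p`,
the free circle `φ j` is the component `freeComp j`, and every geometric clause is the old
clause at the chord `κ⁻¹ j`. GPV (2000), §1. [cite: GPV2000, §1] -/
def relabel (τ : Equiv.Perm (Fin (2 * P.diagram.n))) (κ : Equiv.Perm (Fin P.diagram.n))
    (φ : Equiv.Perm (Fin P.diagram.free)) : L.RegularProjection where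
  diagram := P.diagram.relabel τ κ
  comp := P.comp ∘ τ.symm
  θ := P.θ ∘ τ.symm
  traversal := P.traversal.conj τ
  freeComp := φ.symm.toEmbedding.trans P.freeComp
  range_freeComp := by
    show range (P.freeComp ∘ φ.symm) = (range (P.comp ∘ τ.symm))ᶜ
    rw [EquivLike.range_comp, EquivLike.range_comp, P.range_freeComp]
  northPole_notMem := P.northPole_notMem
  deriv_ne_zero := P.deriv_ne_zero
  double j := by
    simp only [LinkGaussDiagram.relabel, comp_apply, Equiv.symm_apply_apply]
    exact P.double _
  eq_or_crossing a b s t hst := by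
    rcases P.eq_or_crossing a b s t hst with h | ⟨i, k, l, h⟩
    · exact Or.inl h
    · refine Or.inr ⟨κ i, k, l, ?_⟩
      simp only [LinkGaussDiagram.relabel, comp_apply, Equiv.symm_apply_apply]
      exact h
  heightCurve_lt j := by
    simp only [LinkGaussDiagram.relabel, comp_apply, Equiv.symm_apply_apply]
    exact P.heightCurve_lt _
  sign_eq j := by
    simp only [LinkGaussDiagram.relabel, comp_apply, Equiv.symm_apply_apply]
    exact P.sign_eq _

/-- The relabelled projection reads the relabelled diagram. [folklore] -/
@[simp] theorem relabel_diagram (τ : Equiv.Perm (Fin (2 * P.diagram.n)))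
    (κ : Equiv.Perm (Fin P.diagram.n)) (φ : Equiv.Perm (Fin P.diagram.free)) :
    (P.relabel τ κ φ).diagram = P.diagram.relabel τ κ := rfl

/-- The velocity of the plane curve of a knot is `2π`-periodic (cf.
`periodic_deriv_of_periodic` of `GaussDiagramsPerturbation`, not imported here). [folklore] -/
theorem _root_.Literature.Topology.FourManifolds.Knot.periodic_deriv_planeCurve (K : Knot) :
    Periodic (deriv K.planeCurve) (2 * Real.pi) := fun t ↦ by
  rw [← deriv_comp_add_const]
  exact congrArg (deriv · t) (funext K.periodic_planeCurve)

/-- **Re-parametrisation by periods**: shifting the parameters of the marked points on each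
component `a` by `k a` full periods gives a regular projection reading the same diagram (each
window moves rigidly; plane curves, heights and velocities are `2π`-periodic). [folklore] -/
def shift (k : ι → ℤ) : L.RegularProjection where
  diagram := P.diagram
  comp := P.comp
  θ p := P.θ p + k (P.comp p) * (2 * Real.pi)
  traversal := P.traversal.add_comp fun a ↦ k a * (2 * Real.pi)
  freeComp := P.freeComp
  range_freeComp := P.range_freeComp
  northPole_notMem := P.northPole_notMem
  deriv_ne_zero := P.deriv_ne_zero
  double i := by
    rw [(Knot.periodic_planeCurve _).int_mul, (Knot.periodic_planeCurve _).int_mul]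
    exact P.double i
  eq_or_crossing a b s t hst := by
    rcases P.eq_or_crossing a b s t hst with h | ⟨i, k₁, k₂, h⟩
    · exact Or.inl h
    · -- move each shifted parameter by the period count of the component it lands on
      have aux : ∀ {a : ι} {s : ℝ} {k₁ : ℤ} {p : Fin (2 * P.diagram.n)},
          (a, s + k₁ * (2 * Real.pi)) = (P.comp p, P.θ p) →
            (a, s + ((k₁ + k a : ℤ) : ℝ) * (2 * Real.pi)) =
              (P.comp p, P.θ p + k (P.comp p) * (2 * Real.pi)) := by
        intro a s k₁ p h
        obtain ⟨rfl, hs⟩ := Prod.ext_iff.1 h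
        refine Prod.ext rfl ?_
        dsimp only at hs ⊢
        rw [← hs]
        push_cast
        ring
      rcases pair_eq_pair_iff.1 h with ⟨h1, h2⟩ | ⟨h1, h2⟩
      · exact Or.inr ⟨i, k₁ + k a, k₂ + k b, pair_eq_pair_iff.2 (Or.inl ⟨aux h1, aux h2⟩)⟩
      · exact Or.inr ⟨i, k₁ + k a, k₂ + k b, pair_eq_pair_iff.2 (Or.inr ⟨aux h1, aux h2⟩)⟩
  heightCurve_lt i := by
    rw [(Knot.periodic_heightCurve _).int_mul, (Knot.periodic_heightCurve _).int_mul]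
    exact P.heightCurve_lt i
  sign_eq i := by
    rw [(Knot.periodic_deriv_planeCurve _).int_mul, (Knot.periodic_deriv_planeCurve _).int_mul]
    exact P.sign_eq i

/-- The shifted projection reads the same diagram. [folklore] -/
@[simp] theorem shift_diagram (k : ι → ℤ) : (P.shift k).diagram = P.diagram := rfl

end Link.RegularProjection

/-- **`HasGaussDiagram` is closed under relabelling of the diagram.** GPV (2000), §1.
[cite: GPV2000, §1] -/
theorem Link.HasGaussDiagram.relabel {ι : Type*} {L : Link ι} {D : LinkGaussDiagram}
    (h : L.HasGaussDiagram D) (τ : Equiv.Perm (Fin (2 * D.n))) (κ : Equiv.Perm (Fin D.n)) :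
    L.HasGaussDiagram (D.relabel τ κ) := by
  obtain ⟨P, rfl⟩ := h; exact ⟨P.relabel τ κ 1, rfl⟩

/-- Hence `HasGaussDiagram` is constant on `LinkGaussDiagram.IsRelabelling` classes. [folklore] -/
theorem Link.HasGaussDiagram.of_isRelabelling {ι : Type*} {L : Link ι} {D D' : LinkGaussDiagram}
    (h : L.HasGaussDiagram D) (hD : D.IsRelabelling D') : L.HasGaussDiagram D' := by
  obtain ⟨τ, κ, rfl⟩ := hD; exact h.relabel τ κ

/-! ## 5. Checkerboard colourings: the input of the next layer -/

namespace LinkGaussDiagram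

/-- `ofKnotDiagram G` and `ofGaussDiagram G` have the same chords and the same traversal, hence
the same checkerboard colourings (`LinkGaussDiagram.IsCheckerboard` of `LinkLeeStates`; with
`isCheckerboard_ofGaussDiagram`: Gauss parity colours `ofKnotDiagram G` by position parity).
[folklore] -/
theorem isCheckerboard_ofKnotDiagram_iff (G : GaussDiagram) (c : Fin (2 * G.n) → Bool) :
    (ofKnotDiagram G).IsCheckerboard c ↔ (ofGaussDiagram G).IsCheckerboard c :=
  ⟨fun h ↦ ⟨h.1, h.2⟩, fun h ↦ ⟨h.1, h.2⟩⟩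

/-- **A checkerboard-colourable diagram has an even number of chord ends on every component**:
the colour alternates around the cycle of `p` under `next` and returns to its value, so the
length `minimalPeriod next p` of the cycle is even (Kauffman (1999), §2). [folklore] -/
theorem IsCheckerboard.even_minimalPeriod {D : LinkGaussDiagram} {c : Fin (2 * D.n) → Bool}
    (hc : D.IsCheckerboard c) (p : Fin (2 * D.n)) : Even (minimalPeriod D.next p) := by
  have hk : ∀ k, (c (D.next^[k] p) = c p ↔ Even k) := by
    intro k
    induction k with
    | zero => simp
    | succ k ih =>
      rw [iterate_succ_apply', hc.apply_next, Nat.even_add_one, ← ih]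
      cases c (D.next^[k] p) <;> cases c p <;> simp
  exact (hk _).1 (by rw [iterate_minimalPeriod])

end LinkGaussDiagram

end Literature.Topology.FourManifolds

end
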